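/-
Copyright (c) 2026. All rights reserved.
Released under Apache 2.0 license as described in the file LICENSE.
Authors: abc-iut cell, prover seat abc-iut-L4-d2 (gen 6).
-/
import Literature.AnabelianGeometry.AbsoluteAnabelian.GaloisTheatersNumberFieldShadowPanalocal
import Literature.AnabelianGeometry.AbsoluteAnabelian.GaloisTheatersNumberFieldShadowFunctorial
import Literature.AnabelianGeometry.AbsoluteAnabelian.AbsTopI.SemiAbsoluteChains
import HarnessLib

/-!
# [AbsTopIII] Def 5.1 (ii)/(iii) at the number-field shadow context: `Aut(Π)` and the morphisms of `EA⊚` through the chart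

S. Mochizuki, *Topics in absolute anabelian geometry III* [MochizukiAbsTopIII2015], Def 5.1 (ii) p. 115 (`V⊚(Π)/Aut(Π)`,
"in natural bijective correspondence with `V⊚(F_mod)`") and (iii) p. 115 (morphisms of `EA⊚`).  At the shadow context
`NumberFieldShadow.context F` (abc-iut-L4-d2 g6) an admissible `Π_E` carries an INJECTIVE `ℚ`-chart `ratChart E : Π_E ↪ Γ = G_ℚ`
with open range `U_E` (`GaloisTheatersNumberFieldShadowPanalocal.lean`).  This PROOF-ONLY file describes `Aut(Π_E)` and the
morphisms of `EA⊚` between admissible objects in these coordinates — the input of the panalocalization functoriality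
F-0183 (`GaloisTheatersNumberFieldShadowPanalocalHom.lean`):

* (by name from abc-iut-L4-t3's `GaloisTheatersNumberFieldShadowFunctorial.lean`: `conjugator_unique` — the
  conjugator `τ_f` of a morphism from a charted object is UNIQUE, slimness of `G_ℚ`);
* `exists_rangeEquiv_ratChart` — `Π_E ≃ₜ* U_E` for admissible `E`;
* `exists_conj_range_eq_of_isAdmissible` — the ranges of the charts of two admissible objects are CONJUGATE in `Γ`
  (both `Π`'s are `≅ G_F`; two injective charts of one group are conjugate);
* **`map_conj_conjugator_range_eq`** — for a morphism `f : Π₁ ↪ Π₂` of `EA⊚` between ADMISSIBLE objects,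
  `τ_f U₁ τ_f⁻¹ = U₂`: the open injection is onto in chart coordinates (Neukirch–Uchida + a finite-index count —
  an open subgroup of `G_ℚ` conjugate into itself is conjugate onto itself); in particular `f` is bijective on `Π`
  (`arith_bijective_of_isEAHom`);
* **`exists_iso_of_map_conj_range_eq`** — conversely every `σ ∈ Γ` normalising `U_E` IS the conjugator of an
  automorphism `α_σ ∈ Aut(E)` in `EA⊚` (`Π_E ≅ U_E --conj σ--> U_E ≅ Π_E`, transported to `G_E` along the bijection `aug`);
  so `V⊚(Π_E)/Aut(Π_E)` is the quotient of `V⊚(ℚ̄/ℚ)` by the normaliser `N_Γ(U_E) = G_{F₀}`, `F₀ = F^{Aut F}` — the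
  shadow's `V⊚(F_mod)`.

HONEST LABEL: shadow-level (`Δ = 1`); classical; nothing here bears on [IUTchIII] Cor. 3.12 or takes a side.
-/

noncomputable section

open scoped Pointwise Topology
open CategoryTheory NumberField Field

namespace Literature.AnabelianGeometry.AbsoluteAnabelian

namespace NumberFieldShadow

variable (F : Type) [Field F] [NumberField F]

/-! ### The chart of an admissible `Π` as an isomorphism onto its range -/

/-- `Π_E ≃ₜ* U_E := ratChart(Π_E)` for admissible `E` (the chart is injective and `Π_E` is compact).
[cite: MochizukiAbsTopIII2015, Def 5.1 (ii) p.114] -/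
theorem exists_rangeEquiv_ratChart {E : FundamentalExtension.{0}} (hE : IsAdmissible F E) :
    ∃ θ : E.arith ≃ₜ* (ratChart E).toMonoidHom.range, ∀ g : E.arith, ((θ g : (ratChart E).toMonoidHom.range) :
      absoluteGaloisGroup ℚ) = ratChart E g := by
  let e₀ : E.arith ≃* (ratChart E).toMonoidHom.range := MonoidHom.ofInjective (ratChart_injective_of_isAdmissible F hE)
  have hc : Continuous e₀ := (ratChart E).continuous.subtype_mk _
  exact ⟨{ e₀ with
      continuous_toFun := hc
      continuous_invFun := Continuous.continuous_symm_of_equiv_compact_to_t2 (f := e₀.toEquiv) hc },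
    fun _ => rfl⟩

/-- `aug : Π_E ≃ₜ* G_E` for admissible `E` (at the shadow `Δ = 1`, so `aug` is a continuous bijection of compact
Hausdorff groups). [cite: MochizukiAbsTopIII2015, Def 5.1 (ii) p.113] -/
theorem exists_augEquiv {E : FundamentalExtension.{0}} (hE : IsAdmissible F E) :
    ∃ η : E.arith ≃ₜ* E.gal, ∀ g : E.arith, η g = E.aug g := by
  let e₀ : E.arith ≃* E.gal := MulEquiv.ofBijective E.aug.toMonoidHom (aug_bijective_of_isAdmissible F hE)
  have hc : Continuous e₀ := E.aug.continuous
  exact ⟨{ e₀ with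
      continuous_toFun := hc
      continuous_invFun := Continuous.continuous_symm_of_equiv_compact_to_t2 (f := e₀.toEquiv) hc },
    fun _ => rfl⟩

/-! ### The ranges of the charts of admissible objects -/

/-- **The chart ranges of two admissible objects are conjugate in `Γ`**: `Π₁ ≅ E_F ≅ Π₂` and two injective
`ℚ`-charts of one compact group are `Γ`-conjugate. [cite: NeukirchSchmidtWingberg2008, Thm (12.2.1)] -/
theorem exists_conj_range_eq_of_isAdmissible {E₁ E₂ : FundamentalExtension.{0}} (h₁ : IsAdmissible F E₁)
    (h₂ : IsAdmissible F E₂) :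
    ∃ ρ : absoluteGaloisGroup ℚ, ((ratChart E₁).toMonoidHom.range).map (MulAut.conj ρ).toMonoidHom =
      (ratChart E₂).toMonoidHom.range := by
  obtain ⟨e₁⟩ := h₁
  obtain ⟨e₂⟩ := h₂
  let g : E₁ ≅ E₂ := e₁ ≪≫ e₂.symm
  -- `ratChart E₂ ∘ g` is an injective chart of `Π₁`
  have hgi : Function.Injective g.hom.arith := (AbsTopI.isoArith g).injective
  have hgo : IsOpen (Set.range g.hom.arith) := by
    rw [show Set.range g.hom.arith = Set.univ from (AbsTopI.isoArith g).surjective.range_eq]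
    exact isOpen_univ
  obtain ⟨ρ, hρ⟩ := VirtualChart.Rat.exists_conj_of_charts (ratChart E₁) ((ratChart E₂).comp g.hom.arith)
    (ratChart_spec (hasRatChart_of_isAdmissible F ⟨e₁⟩))
    (VirtualChart.Rat.chart_comp_of_openInjective g.hom.arith hgi hgo _
      (ratChart_spec (hasRatChart_of_isAdmissible F ⟨e₂⟩)))
  refine ⟨ρ, ?_⟩
  ext x
  simp only [Subgroup.mem_map, MonoidHom.mem_range]
  constructor
  · rintro ⟨_, ⟨a, rfl⟩, rfl⟩
    refine ⟨g.hom.arith a, ?_⟩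
    have := hρ a
    change ratChart E₂ (g.hom.arith a) = _ at this
    exact this
  · rintro ⟨b, rfl⟩
    refine ⟨ratChart E₁ (g.inv.arith b), ⟨g.inv.arith b, rfl⟩, ?_⟩
    have := hρ (g.inv.arith b)
    change ratChart E₂ (g.hom.arith (g.inv.arith b)) = _ at this
    rw [AbsTopI.iso_hom_inv_arith] at this
    exact this.symm

/-- The chart range of an admissible object has finite index in `Γ`. [cite: MochizukiAbsTopIII2015, Def 5.1 (iii) p.115] -/
theorem finiteIndex_range_ratChart {E : FundamentalExtension.{0}} (hE : IsAdmissible F E) :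
    ((ratChart E).toMonoidHom.range).FiniteIndex := by
  haveI : Finite (absoluteGaloisGroup ℚ ⧸ (ratChart E).toMonoidHom.range) :=
    Subgroup.quotient_finite_of_isOpen _ (isOpen_range_ratChart_of_isAdmissible F hE)
  exact Subgroup.finiteIndex_of_finite_quotient

/-- **A morphism of `EA⊚` between ADMISSIBLE objects is onto in chart coordinates**: `τ_f U₁ τ_f⁻¹ = U₂` for the chart
ranges `Uᵢ = ratChart(Πᵢ)` (the inclusion `⊆` is the chart-transition law; equality because `U₁`, `U₂` are conjugate
open subgroups of `G_ℚ`, so both sides have the same finite index). [cite: MochizukiAbsTopIII2015, Def 5.1 (iii) p.115] -/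
theorem map_conj_conjugator_range_eq {E₁ E₂ : FundamentalExtension.{0}} (h₁ : IsAdmissible F E₁)
    (h₂ : IsAdmissible F E₂) (f : E₁ ⟶ E₂) (hf : IsEAHom f) :
    ((ratChart E₁).toMonoidHom.range).map (MulAut.conj (conjugator f hf)).toMonoidHom =
      (ratChart E₂).toMonoidHom.range := by
  obtain ⟨ρ, hρ⟩ := exists_conj_range_eq_of_isAdmissible F h₁ h₂
  -- `⊆` from the transition law
  have hle : ((ratChart E₁).toMonoidHom.range).map (MulAut.conj (conjugator f hf)).toMonoidHom ≤
      (ratChart E₂).toMonoidHom.range := by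
    rintro _ ⟨_, ⟨a, rfl⟩, rfl⟩
    refine ⟨f.arith a, ?_⟩
    change ratChart E₂ (f.arith a) = _
    rw [ratChart_comp_eq_conj f hf a]
    rfl
  -- equal indices
  haveI : ((ratChart E₁).toMonoidHom.range).FiniteIndex := finiteIndex_range_ratChart F h₁
  have hidx : (((ratChart E₁).toMonoidHom.range).map (MulAut.conj (conjugator f hf)).toMonoidHom).index =
      ((ratChart E₂).toMonoidHom.range).index := by
    rw [← hρ]
    change (((ratChart E₁).toMonoidHom.range).map
        ((MulAut.conj (conjugator f hf) : absoluteGaloisGroup ℚ ≃* absoluteGaloisGroup ℚ) :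
          absoluteGaloisGroup ℚ →* absoluteGaloisGroup ℚ)).index =
      (((ratChart E₁).toMonoidHom.range).map ((MulAut.conj ρ : absoluteGaloisGroup ℚ ≃* absoluteGaloisGroup ℚ) :
          absoluteGaloisGroup ℚ →* absoluteGaloisGroup ℚ)).index
    rw [Subgroup.index_map_equiv, Subgroup.index_map_equiv]
  haveI : (((ratChart E₁).toMonoidHom.range).map (MulAut.conj (conjugator f hf)).toMonoidHom).FiniteIndex := by
    change (((ratChart E₁).toMonoidHom.range).map
      ((MulAut.conj (conjugator f hf) : absoluteGaloisGroup ℚ ≃* absoluteGaloisGroup ℚ) :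
        absoluteGaloisGroup ℚ →* absoluteGaloisGroup ℚ)).FiniteIndex
    refine ⟨?_⟩
    rw [Subgroup.index_map_equiv]
    exact Subgroup.FiniteIndex.index_ne_zero
  by_contra hne
  exact absurd hidx (Subgroup.index_strictAnti (lt_of_le_of_ne hle hne)).ne'

/-- **A morphism of `EA⊚` between admissible objects is BIJECTIVE on `Π`.**
[cite: MochizukiAbsTopIII2015, Def 5.1 (iii) p.115] -/
theorem arith_bijective_of_isEAHom {E₁ E₂ : FundamentalExtension.{0}} (h₁ : IsAdmissible F E₁)
    (h₂ : IsAdmissible F E₂) (f : E₁ ⟶ E₂) (hf : IsEAHom f) : Function.Bijective f.arith := by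
  refine ⟨hf.injective, fun y => ?_⟩
  have hy : ratChart E₂ y ∈ (ratChart E₂).toMonoidHom.range := ⟨y, rfl⟩
  rw [← map_conj_conjugator_range_eq F h₁ h₂ f hf] at hy
  obtain ⟨_, ⟨x, rfl⟩, hx⟩ := hy
  refine ⟨x, ratChart_injective_of_isAdmissible F h₂ ?_⟩
  rw [ratChart_comp_eq_conj f hf x]
  exact hx

/-! ### Automorphisms of an admissible object from the normaliser of its chart range -/

/-- **Every `σ ∈ Γ` normalising `U_E` is the conjugator of an automorphism of `E` in `EA⊚`**: the automorphism is
`Π_E ≅ U_E --conj σ--> U_E ≅ Π_E` on `Π` and its transport along the bijection `aug : Π_E ≅ G_E` on `G`.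
[cite: MochizukiAbsTopIII2015, Def 5.1 (ii) p.115] -/
theorem exists_iso_of_map_conj_range_eq {E : FundamentalExtension.{0}} (hE : IsAdmissible F E)
    (σ : absoluteGaloisGroup ℚ)
    (hσ : ((ratChart E).toMonoidHom.range).map (MulAut.conj σ).toMonoidHom = (ratChart E).toMonoidHom.range) :
    ∃ (α : E ≅ E) (hα : IsEAHom α.hom), conjugator α.hom hα = σ := by
  set U := (ratChart E).toMonoidHom.range
  obtain ⟨θ, hθ⟩ := exists_rangeEquiv_ratChart F hE
  obtain ⟨η, hη⟩ := exists_augEquiv F hE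
  -- conjugation by `σ` on `U`
  have hmemU : ∀ u : U, σ * (u : absoluteGaloisGroup ℚ) * σ⁻¹ ∈ U := fun u => by
    have h : σ * (u : absoluteGaloisGroup ℚ) * σ⁻¹ ∈ U.map (MulAut.conj σ).toMonoidHom := ⟨u, u.2, rfl⟩
    rwa [hσ] at h
  have hmemU' : ∀ u : U, σ⁻¹ * (u : absoluteGaloisGroup ℚ) * σ⁻¹⁻¹ ∈ U := fun u => by
    have hu : (u : absoluteGaloisGroup ℚ) ∈ U.map (MulAut.conj σ).toMonoidHom := by rw [hσ]; exact u.2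
    obtain ⟨w, hw, hwu⟩ := hu
    have : σ⁻¹ * (u : absoluteGaloisGroup ℚ) * σ⁻¹⁻¹ = w := by
      rw [← hwu]; change σ⁻¹ * (σ * w * σ⁻¹) * σ⁻¹⁻¹ = w; group
    rw [this]; exact hw
  let c : U ≃* U :=
    { toFun := fun u => ⟨σ * u * σ⁻¹, hmemU u⟩
      invFun := fun u => ⟨σ⁻¹ * u * σ⁻¹⁻¹, hmemU' u⟩
      left_inv := fun u => Subtype.ext (by change σ⁻¹ * (σ * (u : absoluteGaloisGroup ℚ) * σ⁻¹) * σ⁻¹⁻¹ = u; group)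
      right_inv := fun u => Subtype.ext (by change σ * (σ⁻¹ * (u : absoluteGaloisGroup ℚ) * σ⁻¹⁻¹) * σ⁻¹ = u; group)
      map_mul' := fun u v => Subtype.ext (by
        change σ * ((u : absoluteGaloisGroup ℚ) * v) * σ⁻¹ = σ * u * σ⁻¹ * (σ * v * σ⁻¹); group) }
  have hcc : Continuous c := by
    refine Continuous.subtype_mk ?_ _
    exact (continuous_const.mul continuous_subtype_val).mul continuous_const
  have hcc' : Continuous c.symm := by
    refine Continuous.subtype_mk ?_ _
    exact (continuous_const.mul continuous_subtype_val).mul continuous_const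
  let cC : U ≃ₜ* U := { c with continuous_toFun := hcc, continuous_invFun := hcc' }
  -- the automorphism of `Π` and of `G`
  let a : E.arith ≃ₜ* E.arith := (θ.trans cC).trans θ.symm
  let b : E.gal ≃ₜ* E.gal := (η.symm.trans a).trans η
  have ha : ∀ g : E.arith, ratChart E (a g) = σ * ratChart E g * σ⁻¹ := by
    intro g
    have h1 : ratChart E (a g) = ((θ (a g) : U) : absoluteGaloisGroup ℚ) := (hθ (a g)).symm
    rw [h1]
    change ((θ (θ.symm (cC (θ g))) : U) : absoluteGaloisGroup ℚ) = _
    rw [θ.apply_symm_apply]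
    change σ * ((θ g : U) : absoluteGaloisGroup ℚ) * σ⁻¹ = _
    rw [hθ g]
  have hcomm : ∀ x : E.arith, E.aug (a x) = b (E.aug x) := by
    intro x
    change _ = η (a (η.symm (E.aug x)))
    rw [← hη x, η.symm_apply_apply, hη]
  have hcomm' : ∀ x : E.arith, E.aug (a.symm x) = b.symm (E.aug x) := by
    intro x
    rw [ContinuousMulEquiv.eq_symm_apply, ← hcomm, a.apply_symm_apply]
  let toHom : ∀ (p : E.arith ≃ₜ* E.arith) (q : E.gal ≃ₜ* E.gal), (∀ x, E.aug (p x) = q (E.aug x)) → (E ⟶ E) :=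
    fun p q hpq => ⟨{ toMonoidHom := p.toMulEquiv.toMonoidHom, continuous_toFun := p.continuous },
      { toMonoidHom := q.toMulEquiv.toMonoidHom, continuous_toFun := q.continuous }, hpq⟩
  let α : E ≅ E :=
    { hom := toHom a b hcomm
      inv := toHom a.symm b.symm hcomm'
      hom_inv_id := FundamentalExtension.Hom.ext (ContinuousMonoidHom.ext fun x => a.symm_apply_apply x)
        (ContinuousMonoidHom.ext fun x => b.symm_apply_apply x)
      inv_hom_id := FundamentalExtension.Hom.ext (ContinuousMonoidHom.ext fun x => a.apply_symm_apply x)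
        (ContinuousMonoidHom.ext fun x => b.apply_symm_apply x) }
  have hgeom := geom_eq_bot_of_isAdmissible F hE
  have hα : IsEAHom α.hom :=
    { bijOn_geom := by
        rw [hgeom]
        refine ⟨fun x hx => ?_, fun x _ y _ h => a.injective h, fun y hy => ?_⟩
        · rw [Subgroup.coe_bot, Set.mem_singleton_iff] at hx ⊢
          rw [hx]; exact map_one a
        · rw [Subgroup.coe_bot, Set.mem_singleton_iff] at hy
          exact ⟨1, (Subgroup.coe_bot (G := E.arith)) ▸ rfl, by rw [hy]; exact map_one a⟩
      injective := a.injective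
      isOpen_range := by
        rw [show Set.range α.hom.arith = Set.univ from a.surjective.range_eq]
        exact isOpen_univ }
  refine ⟨α, hα, (conjugator_unique α.hom hα (hasRatChart_of_isAdmissible F hE) fun g => ha g).symm⟩

/-- **The conjugator of an automorphism normalises the chart range**: `τ_α U_E τ_α⁻¹ = U_E` for `α ∈ Aut(E)`, `E`
admissible. [cite: MochizukiAbsTopIII2015, Def 5.1 (ii) p.115] -/
theorem map_conj_conjugator_range_eq_self {E : FundamentalExtension.{0}} (hE : IsAdmissible F E) (α : E ≅ E)
    (hα : IsEAHom α.hom) :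
    ((ratChart E).toMonoidHom.range).map (MulAut.conj (conjugator α.hom hα)).toMonoidHom =
      (ratChart E).toMonoidHom.range :=
  map_conj_conjugator_range_eq F hE hE α.hom hα

end NumberFieldShadow

end Literature.AnabelianGeometry.AbsoluteAnabelian

end
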